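import Summits.HubbardSuperconductivity.HubbardSuperconductivity.Theses.ThermalWedge
import Summits.HubbardSuperconductivity.HubbardSuperconductivity.Theorems.ThermalWedgeTwSourcedInertnessLadder
import Literature.MathematicalPhysics.QuantumLattice.GibbsPressureTemperature
import Literature.MathematicalPhysics.QuantumLattice.DWaveSourceProofs

/-!
# Route `ThermalWedge`, crux `TwSourcedCondensation` (item `stmt-HubbardSuperconductivity-1697`):
# the entropy-staircase skeleton (line `entropy-staircase-linear-regime`)

The crux asks, for every compact `[μ₁,μ₂] ⊂ (-4,0)`, constants `U₀ a c C h₀ > 0` such that for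
`0 < U ≤ U₀`, `1 ≤ β ≤ e^{a/U}`, `μ ∈ [μ₁,μ₂]`, eventually in `L`, for `|h| ≤ h₀`:
`c h² log(1/(|h|+1/β)) − C h² ≤ p̃_L(β,U,μ,h) − p̃_L(β,U,μ,0)`,
`p̃_L(β,U,μ,h) = log Re Z_β(dWaveSourceTorus L U μ h)/(βL²)` (the sourced torus pressure).

LINE (entropy staircase / thermal ratchet). Two chords of the convex, decreasing map
`β ↦ β⁻¹ log Z_β` (tree: `GibbsPressureTemperature`) give the exact finite-volume RATCHET
`[p̃(β₁,h) − p̃(β₁,0)] − [p̃(β₁/2,h) − p̃(β₁,h)] ≤ p̃(β,h) − p̃(β,0)` for `0 < β₁ ≤ β`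
(`thermalRatchet_dWaveSource`). Hence the crux only needs the LINEAR regime `|h| ≤ 1/β`:
* (F)  free (`U = 0`) Cooper logarithm on the window `|h| ≤ 1/β` (`stub_freeLinearCooperLog`);
* (Fh) free dyadic heat chord `p̃₀(β/2,h) − p̃₀(β,h) ≤ C₁/β²` on the window (`stub_freeLinearThermalLaw`);
* (S)  interaction slack of the sourced gain on the window, `∀ η ∃ U₀ a K`, `≥ −(η log β + K)h²`
       (`stub_sourceSlack`, the constructive content: one-cutoff sourced expansion, difference form);
* (T)  interaction slack of the heat chord on the window, `∀ η ∃ U₀ a K'`, `≤ (η log β + K')/β²`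
       (`stub_thermalSlack`).
For `1/β < |h| ≤ 1/4` one climbs to the dyadic rung `β₁ = β/2^k` with `β₁|h| ≤ 1 < 2β₁|h|`
(`tw_aux_minimal_rung`, sister crux 1696), applies (F,S) at `β₁` (`log β₁ ≥ log(1/|h|) − log 2`) and pays
the heat chord `(C₁ + K' + (c₀/16) log β₁)/β₁² ≤ 4(C₁+K')h² + (c₀/4)h² log β₁`; `L₀` is the finite
maximum of the stub thresholds over the ladder `j ≤ ⌈β⌉₊`, so the crux's quantifier order
(`∃ L₀` after `β, μ`, before `h`) is respected. Constants: `c = c₀/2`, `h₀ = 1/4`,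
`C = C₀ + K + 4C₁ + 4K' + c₀`, `U₀ = min`, `a = min`.

Disproof honoured (`Cruxes/TwSourcedCondensation/Disproof.lean`, `Theorems/…/Negative/*`): `log β`
floors only on `|h| ≤ 1/β` (`false_logBeta`), `L₀` grows with `β` (`false_allL`,
`false_frozenThreshold_of_gap`), both `|h|` and `1/β` inside the log (`false_noCutoff`), order `h²`
(`false_linearResponse`).

Sources: Ruelle, *Statistical Mechanics* (1969) §2.5–2.6 (thermodynamic convexity in `β`); the tree's
`GibbsPressureTemperature`; crux workfile `Cruxes/TwSourcedCondensation/TriageR1K3Ratchet.lean`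
(`CruxTriage1697.thermalRatchet_corrected`, re-derived here because crux workfiles are not importable).
-/

noncomputable section

namespace Summit.HubbardSuperconductivity.HubbardSuperconductivity.Theorems

open Matrix Finset Literature.MathematicalPhysics.QuantumLattice
open Summit.HubbardSuperconductivity.HubbardSuperconductivity.Theses.ThermalWedge

/-! ### The four stubs (registered; `sorry` only here) -/

/-- **Stub (F): free linear-regime Cooper logarithm.** For the `U = 0` sourced torus, on the window
`|h| ≤ 1/β`: `c₀ h² log β − C₀ h² ≤ p̃₀(β,h) − p̃₀(β,0)`, eventually in `L` (per `β, μ`). Provable now from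
`log_partitionFn_dWaveSourceTorus_zero_sub` + concavity of `x ↦ log cosh(β√x/2)` + shell counting. -/
theorem stub_freeLinearCooperLog :
    ∀ μ₁ μ₂ : ℝ, -4 < μ₁ → μ₁ ≤ μ₂ → μ₂ < 0 → ∃ c₀ C₀ : ℝ, 0 < c₀ ∧ 0 < C₀ ∧ ∀ β : ℝ, 1 ≤ β → ∀ μ ∈
      Set.Icc μ₁ μ₂, ∃ L₀ : ℕ, ∀ (L : ℕ) [NeZero L], L₀ ≤ L → ∀ h : ℝ, |h| ≤ 1 / β → c₀ * h ^ 2 *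
      Real.log β - C₀ * h ^ 2 ≤ Real.log (Matrix.partitionFn β
      (Literature.MathematicalPhysics.QuantumLattice.dWaveSourceTorus L 0 μ h)).re / (β * (L : ℝ) ^ 2)
      - Real.log (Matrix.partitionFn β (Literature.MathematicalPhysics.QuantumLattice.dWaveSourceTorus
      L 0 μ 0)).re / (β * (L : ℝ) ^ 2) := by
  sorry

/-- **Stub (Fh): free thermal law (dyadic heat chord).** For the `U = 0` sourced torus, on the window
`|h| ≤ 1/β`: `p̃₀(β/2,h) − p̃₀(β,h) ≤ C₁/β²`, eventually in `L` (per `β, μ`). Provable now (Sommerfeld-type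
bound `Σ_k e^{−β|ξ_k|/2} ≲ L²/β + L` from torus shell counting). -/
theorem stub_freeLinearThermalLaw :
    ∀ μ₁ μ₂ : ℝ, -4 < μ₁ → μ₁ ≤ μ₂ → μ₂ < 0 → ∃ C₁ : ℝ, 0 < C₁ ∧ ∀ β : ℝ, 1 ≤ β → ∀ μ ∈ Set.Icc μ₁
      μ₂, ∃ L₀ : ℕ, ∀ (L : ℕ) [NeZero L], L₀ ≤ L → ∀ h : ℝ, |h| ≤ 1 / β → Real.log (Matrix.partitionFn
      (β / 2) (Literature.MathematicalPhysics.QuantumLattice.dWaveSourceTorus L 0 μ h)).re / (β / 2 *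
      (L : ℝ) ^ 2) - Real.log (Matrix.partitionFn β
      (Literature.MathematicalPhysics.QuantumLattice.dWaveSourceTorus L 0 μ h)).re / (β * (L : ℝ) ^ 2)
      ≤ C₁ / β ^ 2 := by
  sorry

/-- **Stub (S): source slack (LOAD-BEARING, constructive).** `∀ η > 0 ∃ U₀ a K`: for `0 < U ≤ U₀`,
`1 ≤ β ≤ e^{a/U}`, on the window `|h| ≤ 1/β`, eventually in `L`:
`[p̃₀(β,h) − p̃₀(β,0)] − (η log β + K)h² ≤ p̃_U(β,h) − p̃_U(β,0)` — the interaction does not destroy the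
free Cooper logarithm in the one-cutoff regime (relative corrections `O(U log β) = O(a)`). -/
theorem stub_sourceSlack :
    ∀ μ₁ μ₂ : ℝ, -4 < μ₁ → μ₁ ≤ μ₂ → μ₂ < 0 → ∀ η : ℝ, 0 < η → ∃ U₀ a K : ℝ, 0 < U₀ ∧ 0 < a ∧ 0 < K
      ∧ ∀ U : ℝ, 0 < U → U ≤ U₀ → ∀ β : ℝ, 1 ≤ β → β ≤ Real.exp (a / U) → ∀ μ ∈ Set.Icc μ₁ μ₂, ∃ L₀ :
      ℕ, ∀ (L : ℕ) [NeZero L], L₀ ≤ L → ∀ h : ℝ, |h| ≤ 1 / β → (Real.log (Matrix.partitionFn β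
      (Literature.MathematicalPhysics.QuantumLattice.dWaveSourceTorus L 0 μ h)).re / (β * (L : ℝ) ^ 2)
      - Real.log (Matrix.partitionFn β (Literature.MathematicalPhysics.QuantumLattice.dWaveSourceTorus
      L 0 μ 0)).re / (β * (L : ℝ) ^ 2)) - (η * Real.log β + K) * h ^ 2 ≤ Real.log (Matrix.partitionFn
      β (Literature.MathematicalPhysics.QuantumLattice.dWaveSourceTorus L U μ h)).re / (β * (L : ℝ) ^
      2) - Real.log (Matrix.partitionFn β
      (Literature.MathematicalPhysics.QuantumLattice.dWaveSourceTorus L U μ 0)).re / (β * (L : ℝ) ^ 2) := by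
  sorry

/-- **Stub (T): thermal slack (constructive).** `∀ η > 0 ∃ U₀ a K'`: for `0 < U ≤ U₀`, `1 ≤ β ≤ e^{a/U}`,
on the window `|h| ≤ 1/β`, eventually in `L`: the interaction correction to the dyadic heat chord is
`≤ (η log β + K')/β²`. (Reshaped from the planner's `K'/β²`: weaker, still sufficient.) -/
theorem stub_thermalSlack :
    ∀ μ₁ μ₂ : ℝ, -4 < μ₁ → μ₁ ≤ μ₂ → μ₂ < 0 → ∀ η : ℝ, 0 < η → ∃ U₀ a K' : ℝ, 0 < U₀ ∧ 0 < a ∧ 0 <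
      K' ∧ ∀ U : ℝ, 0 < U → U ≤ U₀ → ∀ β : ℝ, 1 ≤ β → β ≤ Real.exp (a / U) → ∀ μ ∈ Set.Icc μ₁ μ₂, ∃ L₀
      : ℕ, ∀ (L : ℕ) [NeZero L], L₀ ≤ L → ∀ h : ℝ, |h| ≤ 1 / β → (Real.log (Matrix.partitionFn (β / 2)
      (Literature.MathematicalPhysics.QuantumLattice.dWaveSourceTorus L U μ h)).re / (β / 2 * (L : ℝ)
      ^ 2) - Real.log (Matrix.partitionFn β
      (Literature.MathematicalPhysics.QuantumLattice.dWaveSourceTorus L U μ h)).re / (β * (L : ℝ) ^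
      2)) - (Real.log (Matrix.partitionFn (β / 2)
      (Literature.MathematicalPhysics.QuantumLattice.dWaveSourceTorus L 0 μ h)).re / (β / 2 * (L : ℝ)
      ^ 2) - Real.log (Matrix.partitionFn β
      (Literature.MathematicalPhysics.QuantumLattice.dWaveSourceTorus L 0 μ h)).re / (β * (L : ℝ) ^
      2)) ≤ (η * Real.log β + K') / β ^ 2 := by
  sorry

/-! ### The thermal ratchet (exact, finite volume) -/

/-- **Abstract thermal ratchet.** For Hermitian `K₀, K₁` and `0 < β₁ ≤ β`:
`(2 log Z_{β₁}(K₁) − 2 log Z_{β₁/2}(K₁) − log Z_{β₁}(K₀))/β₁ ≤ (log Z_β(K₁) − log Z_β(K₀))/β`.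
Proof: the `K₀` pressure is antitone in `β`; the `K₁` pressure increment from `β` to `β₁` is paid in the
entropy at `β₁`, which is dominated by the dyadic increment `2 log Z_{β₁/2} − log Z_{β₁}`.
(Adapted from `CruxTriage1697.thermalRatchet_corrected`.) [folklore] -/
theorem thermalRatchet {n : Type*} [Fintype n] [DecidableEq n] [Nonempty n]
    (K₀ K₁ : Matrix n n ℂ) (hK₀ : K₀.IsHermitian) (hK₁ : K₁.IsHermitian)
    {β₁ β : ℝ} (hβ₁ : 0 < β₁) (hle : β₁ ≤ β) :
    (2 * Real.log (partitionFn β₁ K₁).re - 2 * Real.log (partitionFn (β₁ / 2) K₁).re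
        - Real.log (partitionFn β₁ K₀).re) / β₁
      ≤ (Real.log (partitionFn β K₁).re - Real.log (partitionFn β K₀).re) / β := by
  have hβ : 0 < β := lt_of_lt_of_le hβ₁ hle
  have hβh : 0 < β₁ / 2 := half_pos hβ₁
  set L11 := Real.log (partitionFn β₁ K₁).re
  set L1h := Real.log (partitionFn (β₁ / 2) K₁).re
  set L01 := Real.log (partitionFn β₁ K₀).re
  set Lb1 := Real.log (partitionFn β K₁).re
  set Lb0 := Real.log (partitionFn β K₀).re
  set S := Real.log (partitionFn β₁ K₁).re + β₁ * (gibbsState β₁ K₁ K₁).re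
  have hA : Lb0 / β ≤ L01 / β₁ := log_partitionFn_div_antitone hK₀ hβ₁ hle
  have hB : L11 / β₁ - Lb1 / β ≤ (β - β₁) / (β * β₁) * S :=
    pressure_sub_pressure_le_entropy hK₁ hβ hβ₁
  have hC : S ≤ 2 * L1h - L11 := entropy_le_two_mul_log_partitionFn_half_sub hK₁ hβ₁
  have hD : L11 / β₁ ≤ L1h / (β₁ / 2) := log_partitionFn_div_antitone hK₁ hβh (by linarith)
  have hD' : 0 ≤ 2 * L1h - L11 := by
    have h1 : L1h / (β₁ / 2) = 2 * L1h / β₁ := by field_simp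
    rw [h1] at hD
    have h2 := (div_le_div_iff_of_pos_right hβ₁).mp hD
    linarith
  have hA' : Lb0 * β₁ ≤ L01 * β := (div_le_div_iff₀ hβ hβ₁).mp hA
  have hB' : L11 * β - Lb1 * β₁ ≤ (β - β₁) * S := by
    have hpos : 0 < β * β₁ := mul_pos hβ hβ₁
    have := mul_le_mul_of_nonneg_right hB hpos.le
    have e1 : (L11 / β₁ - Lb1 / β) * (β * β₁) = L11 * β - Lb1 * β₁ := by field_simp
    have e2 : (β - β₁) / (β * β₁) * S * (β * β₁) = (β - β₁) * S := by field_simp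
    rw [e1, e2] at this
    exact this
  have hC' : (β - β₁) * S ≤ (β - β₁) * (2 * L1h - L11) :=
    mul_le_mul_of_nonneg_left hC (sub_nonneg.2 hle)
  have hE : (β - β₁) * (2 * L1h - L11) ≤ β * (2 * L1h - L11) := by
    have : 0 ≤ β₁ * (2 * L1h - L11) := mul_nonneg hβ₁.le hD'
    nlinarith
  rw [div_le_div_iff₀ hβ₁ hβ]
  nlinarith

/-- **Thermal ratchet for the sourced torus.** For all `L, U, μ, h` and `0 < β₁ ≤ β`:
`[p̃(β₁,h) − p̃(β₁,0)] − [p̃(β₁/2,h) − p̃(β₁,h)] ≤ p̃(β,h) − p̃(β,0)`. [folklore] -/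
theorem thermalRatchet_dWaveSource (L : ℕ) [NeZero L] (U μ h : ℝ) {β₁ β : ℝ}
    (hβ₁ : 0 < β₁) (hle : β₁ ≤ β) :
    (Real.log (partitionFn β₁ (dWaveSourceTorus L U μ h)).re / (β₁ * (L : ℝ) ^ 2)
        - Real.log (partitionFn β₁ (dWaveSourceTorus L U μ 0)).re / (β₁ * (L : ℝ) ^ 2))
      - (Real.log (partitionFn (β₁ / 2) (dWaveSourceTorus L U μ h)).re / (β₁ / 2 * (L : ℝ) ^ 2)
        - Real.log (partitionFn β₁ (dWaveSourceTorus L U μ h)).re / (β₁ * (L : ℝ) ^ 2))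
      ≤ Real.log (partitionFn β (dWaveSourceTorus L U μ h)).re / (β * (L : ℝ) ^ 2)
        - Real.log (partitionFn β (dWaveSourceTorus L U μ 0)).re / (β * (L : ℝ) ^ 2) := by
  have hβ : 0 < β := lt_of_lt_of_le hβ₁ hle
  have hL : 0 < ((L : ℝ)) ^ 2 := cast_sq_pos_of_neZero L
  have key := thermalRatchet (dWaveSourceTorus L U μ 0) (dWaveSourceTorus L U μ h)
    (dWaveSourceTorus_isHermitian L (isHermitian_hubbardTorusWith L 1 U μ) 0)
    (dWaveSourceTorus_isHermitian L (isHermitian_hubbardTorusWith L 1 U μ) h) hβ₁ hle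
  set L11 := Real.log (partitionFn β₁ (dWaveSourceTorus L U μ h)).re
  set L1h := Real.log (partitionFn (β₁ / 2) (dWaveSourceTorus L U μ h)).re
  set L01 := Real.log (partitionFn β₁ (dWaveSourceTorus L U μ 0)).re
  set Lb1 := Real.log (partitionFn β (dWaveSourceTorus L U μ h)).re
  set Lb0 := Real.log (partitionFn β (dWaveSourceTorus L U μ 0)).re
  have hb1 : β₁ ≠ 0 := hβ₁.ne'
  have hb : β ≠ 0 := hβ.ne'
  have hL' : ((L : ℝ)) ^ 2 ≠ 0 := hL.ne'
  have lhs : (L11 / (β₁ * (L : ℝ) ^ 2) - L01 / (β₁ * (L : ℝ) ^ 2))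
      - (L1h / (β₁ / 2 * (L : ℝ) ^ 2) - L11 / (β₁ * (L : ℝ) ^ 2))
      = ((2 * L11 - 2 * L1h - L01) / β₁) / (L : ℝ) ^ 2 := by
    field_simp
    ring
  have rhs : Lb1 / (β * (L : ℝ) ^ 2) - Lb0 / (β * (L : ℝ) ^ 2) = ((Lb1 - Lb0) / β) / (L : ℝ) ^ 2 := by
    field_simp
  rw [lhs, rhs]
  exact div_le_div_of_nonneg_right key hL.le

/-! ### The composition -/

/-- Monotonicity of the ceiling: `β ≤ e^{a/U}` and `a ≤ a'`, `U > 0` give `β ≤ e^{a'/U}`. [folklore] -/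
theorem le_exp_div_of_le {β a a' U : ℝ} (hU : 0 < U) (h : β ≤ Real.exp (a / U)) (haa : a ≤ a') :
    β ≤ Real.exp (a' / U) :=
  h.trans (Real.exp_le_exp.2 (div_le_div_of_nonneg_right haa hU.le))

/-- The cutoff logarithm is below `log β`: `log(1/(|h| + 1/β)) ≤ log β` for `β > 0`. [folklore] -/
theorem log_cutoff_le_log_beta {β : ℝ} (hβ : 0 < β) (h : ℝ) :
    Real.log (1 / (|h| + 1 / β)) ≤ Real.log β := by
  have h1 : 0 < |h| + 1 / β := by positivity
  refine Real.log_le_log (by positivity) ?_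
  rw [div_le_iff₀ h1]
  have : β * (1 / β) = 1 := by field_simp
  nlinarith [abs_nonneg h, this]

/-- The cutoff logarithm is below `log β₁ + 1` when `1 < 2|h|β₁`. [folklore] -/
theorem log_cutoff_le_log_rung {β β₁ h : ℝ} (hβ : 0 < β) (hβ₁ : 0 < β₁) (hh : 1 < |h| * (2 * β₁)) :
    Real.log (1 / (|h| + 1 / β)) ≤ Real.log β₁ + 1 := by
  have hhpos : 0 < |h| := by
    by_contra h0
    push Not at h0
    have : |h| * (2 * β₁) ≤ 0 := mul_nonpos_of_nonpos_of_nonneg h0 (by positivity)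
    linarith
  have h1 : 0 < |h| + 1 / β := by positivity
  have h2 : 1 / (|h| + 1 / β) ≤ 2 * β₁ := by
    rw [div_le_iff₀ h1]
    have : 0 < 1 / β := by positivity
    nlinarith
  calc Real.log (1 / (|h| + 1 / β)) ≤ Real.log (2 * β₁) := Real.log_le_log (by positivity) h2
    _ = Real.log 2 + Real.log β₁ := Real.log_mul (by norm_num) hβ₁.ne'
    _ ≤ Real.log β₁ + 1 := by
        have : Real.log 2 < 1 := by
          have := Real.log_two_lt_d9
          linarith
        linarith

/-- **The entropy staircase: the crux from the line's four stubs** (F) + (Fh) + (S) + (T) ⇒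
`TwSourcedCondensation` (sorries live only in the four `stub_*` above; the composition is a real proof). -/
theorem TwSourcedCondensation_of : TwSourcedCondensation := by
  have hF := stub_freeLinearCooperLog
  have hFh := stub_freeLinearThermalLaw
  have hS := stub_sourceSlack
  have hT := stub_thermalSlack
  classical
  intro μ₁ μ₂ h4 h12 h0
  obtain ⟨c₀, C₀, hc₀, hC₀, hF⟩ := hF μ₁ μ₂ h4 h12 h0
  obtain ⟨C₁, hC₁, hFh⟩ := hFh μ₁ μ₂ h4 h12 h0
  obtain ⟨U₁, a₁, K, hU₁, ha₁, hK, hS⟩ := hS μ₁ μ₂ h4 h12 h0 (c₀ / 4) (by positivity)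
  obtain ⟨U₂, a₂, K', hU₂, ha₂, hK', hT⟩ := hT μ₁ μ₂ h4 h12 h0 (c₀ / 16) (by positivity)
  refine ⟨min U₁ U₂, min a₁ a₂, c₀ / 2, C₀ + K + 4 * C₁ + 4 * K' + c₀, 1 / 4,
    lt_min hU₁ hU₂, lt_min ha₁ ha₂, by positivity, by positivity, by norm_num, ?_⟩
  intro U hU hUU₀ β hβ hβa μ hμ
  have hβpos : 0 < β := by linarith
  have hUU₁ : U ≤ U₁ := hUU₀.trans (min_le_left _ _)
  have hUU₂ : U ≤ U₂ := hUU₀.trans (min_le_right _ _)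
  have hβa₁ : β ≤ Real.exp (a₁ / U) := le_exp_div_of_le hU hβa (min_le_left _ _)
  have hβa₂ : β ≤ Real.exp (a₂ / U) := le_exp_div_of_le hU hβa (min_le_right _ _)
  -- total versions of the four `eventually in L` hypotheses (at this `U, μ`), then choice functions
  have hF' : ∀ β' : ℝ, ∃ L₀ : ℕ, 1 ≤ β' → ∀ (L : ℕ) [NeZero L], L₀ ≤ L → ∀ h : ℝ, |h| ≤ 1 / β' →
      c₀ * h ^ 2 * Real.log β' - C₀ * h ^ 2 ≤
        Real.log (partitionFn β' (dWaveSourceTorus L 0 μ h)).re / (β' * (L : ℝ) ^ 2) -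
          Real.log (partitionFn β' (dWaveSourceTorus L 0 μ 0)).re / (β' * (L : ℝ) ^ 2) := by
    intro β'
    by_cases hb : 1 ≤ β'
    · obtain ⟨L₀, hL₀⟩ := hF β' hb μ hμ
      exact ⟨L₀, fun _ => hL₀⟩
    · exact ⟨0, fun h1 => (hb h1).elim⟩
  have hFh' : ∀ β' : ℝ, ∃ L₀ : ℕ, 1 ≤ β' → ∀ (L : ℕ) [NeZero L], L₀ ≤ L → ∀ h : ℝ, |h| ≤ 1 / β' →
      Real.log (partitionFn (β' / 2) (dWaveSourceTorus L 0 μ h)).re / (β' / 2 * (L : ℝ) ^ 2) -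
          Real.log (partitionFn β' (dWaveSourceTorus L 0 μ h)).re / (β' * (L : ℝ) ^ 2) ≤
        C₁ / β' ^ 2 := by
    intro β'
    by_cases hb : 1 ≤ β'
    · obtain ⟨L₀, hL₀⟩ := hFh β' hb μ hμ
      exact ⟨L₀, fun _ => hL₀⟩
    · exact ⟨0, fun h1 => (hb h1).elim⟩
  have hS' : ∀ β' : ℝ, ∃ L₀ : ℕ, 1 ≤ β' → β' ≤ Real.exp (a₁ / U) → ∀ (L : ℕ) [NeZero L], L₀ ≤ L →
      ∀ h : ℝ, |h| ≤ 1 / β' →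
      (Real.log (partitionFn β' (dWaveSourceTorus L 0 μ h)).re / (β' * (L : ℝ) ^ 2) -
          Real.log (partitionFn β' (dWaveSourceTorus L 0 μ 0)).re / (β' * (L : ℝ) ^ 2)) -
        (c₀ / 4 * Real.log β' + K) * h ^ 2 ≤
      Real.log (partitionFn β' (dWaveSourceTorus L U μ h)).re / (β' * (L : ℝ) ^ 2) -
        Real.log (partitionFn β' (dWaveSourceTorus L U μ 0)).re / (β' * (L : ℝ) ^ 2) := by
    intro β'
    by_cases hb : 1 ≤ β' ∧ β' ≤ Real.exp (a₁ / U)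
    · obtain ⟨L₀, hL₀⟩ := hS U hU hUU₁ β' hb.1 hb.2 μ hμ
      exact ⟨L₀, fun _ _ => hL₀⟩
    · exact ⟨0, fun h1 h2 => (hb ⟨h1, h2⟩).elim⟩
  have hT' : ∀ β' : ℝ, ∃ L₀ : ℕ, 1 ≤ β' → β' ≤ Real.exp (a₂ / U) → ∀ (L : ℕ) [NeZero L], L₀ ≤ L →
      ∀ h : ℝ, |h| ≤ 1 / β' →
      (Real.log (partitionFn (β' / 2) (dWaveSourceTorus L U μ h)).re / (β' / 2 * (L : ℝ) ^ 2) -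
          Real.log (partitionFn β' (dWaveSourceTorus L U μ h)).re / (β' * (L : ℝ) ^ 2)) -
        (Real.log (partitionFn (β' / 2) (dWaveSourceTorus L 0 μ h)).re / (β' / 2 * (L : ℝ) ^ 2) -
          Real.log (partitionFn β' (dWaveSourceTorus L 0 μ h)).re / (β' * (L : ℝ) ^ 2)) ≤
      (c₀ / 16 * Real.log β' + K') / β' ^ 2 := by
    intro β'
    by_cases hb : 1 ≤ β' ∧ β' ≤ Real.exp (a₂ / U)
    · obtain ⟨L₀, hL₀⟩ := hT U hU hUU₂ β' hb.1 hb.2 μ hμ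
      exact ⟨L₀, fun _ _ => hL₀⟩
    · exact ⟨0, fun h1 h2 => (hb ⟨h1, h2⟩).elim⟩
  choose fF hfF using hF'
  choose fFh hfFh using hFh'
  choose fS hfS using hS'
  choose fT hfT using hT'
  -- L₀: the largest threshold over the dyadic ladder β / 2^j, j ≤ ⌈β⌉₊
  refine ⟨(Finset.range (⌈β⌉₊ + 1)).sup fun j =>
    max (max (fF (β / 2 ^ j)) (fFh (β / 2 ^ j))) (max (fS (β / 2 ^ j)) (fT (β / 2 ^ j))), ?_⟩
  intro L _ hL h hh
  have hLj : ∀ j, j ≤ ⌈β⌉₊ → fF (β / 2 ^ j) ≤ L ∧ fFh (β / 2 ^ j) ≤ L ∧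
      fS (β / 2 ^ j) ≤ L ∧ fT (β / 2 ^ j) ≤ L := by
    intro j hj
    have hmem : j ∈ Finset.range (⌈β⌉₊ + 1) := Finset.mem_range.mpr (Nat.lt_succ_of_le hj)
    have hsup := (Finset.le_sup (f := fun j =>
      max (max (fF (β / 2 ^ j)) (fFh (β / 2 ^ j))) (max (fS (β / 2 ^ j)) (fT (β / 2 ^ j)))) hmem).trans hL
    exact ⟨((le_max_left _ _).trans (le_max_left _ _)).trans hsup,
      ((le_max_right _ _).trans (le_max_left _ _)).trans hsup,
      ((le_max_left _ _).trans (le_max_right _ _)).trans hsup,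
      ((le_max_right _ _).trans (le_max_right _ _)).trans hsup⟩
  have hsq : 0 ≤ h ^ 2 := sq_nonneg h
  -- notation for the pressures
  set P : ℝ → ℝ → ℝ → ℝ := fun b u s =>
    Real.log (partitionFn b (dWaveSourceTorus L u μ s)).re / (b * (L : ℝ) ^ 2) with hPdef
  rcases le_or_gt (|h| * β) 1 with hlin | hout
  · -- Case A: inside the window at β itself (rung j = 0)
    have hwin : |h| ≤ 1 / β := by
      rw [le_div_iff₀ hβpos]
      exact hlin
    have h0 := hLj 0 (Nat.zero_le _)
    simp only [pow_zero, div_one] at h0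
    have h1 := hfF β hβ L h0.1 h hwin
    have h2 := hfS β hβ hβa₁ L h0.2.2.1 h hwin
    have hlogβ : 0 ≤ Real.log β := Real.log_nonneg hβ
    have hcut : Real.log (1 / (|h| + 1 / β)) ≤ Real.log β := log_cutoff_le_log_beta hβpos h
    have h3 : c₀ / 2 * h ^ 2 * Real.log (1 / (|h| + 1 / β)) ≤ c₀ / 2 * h ^ 2 * Real.log β :=
      mul_le_mul_of_nonneg_left hcut (by positivity)
    have h4 : 0 ≤ h ^ 2 * Real.log β := by positivity
    change c₀ / 2 * h ^ 2 * Real.log (1 / (|h| + 1 / β)) - (C₀ + K + 4 * C₁ + 4 * K' + c₀) * h ^ 2 ≤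
      P β U h - P β U 0
    change c₀ * h ^ 2 * Real.log β - C₀ * h ^ 2 ≤ P β 0 h - P β 0 0 at h1
    change (P β 0 h - P β 0 0) - (c₀ / 4 * Real.log β + K) * h ^ 2 ≤ P β U h - P β U 0 at h2
    have h5 : 0 ≤ (4 * C₁ + 4 * K' + c₀) * h ^ 2 := by positivity
    have h6 : 0 ≤ c₀ * (h ^ 2 * Real.log β) := by positivity
    linarith [h1, h2, h3, h4, h5, h6]
  · -- Case B: climb the dyadic ladder to the thermal window
    have hsmall : |h| < 1 / 2 := by linarith
    obtain ⟨k, hkK, hkspec, hone, -, hprev⟩ := tw_aux_minimal_rung one_pos hβ hsmall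
    have hkpos : 0 < k := by
      rcases Nat.eq_zero_or_pos k with hk0 | hkp
      · exfalso
        rw [hk0, pow_zero, div_one] at hkspec
        linarith
      · exact hkp
    have hprev' : 1 < |h| * (2 * (β / 2 ^ k)) := hprev hkpos
    set β₁ : ℝ := β / 2 ^ k with hβ₁def
    have hβ₁pos : 0 < β₁ := by positivity
    have hβ₁le : β₁ ≤ β := div_le_self hβpos.le (one_le_pow₀ (by norm_num))
    have hwin : |h| ≤ 1 / β₁ := by
      rw [le_div_iff₀ hβ₁pos]
      exact hkspec
    have hLk := hLj k hkK
    have h1 := hfF β₁ hone L hLk.1 h hwin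
    have h2 := hfFh β₁ hone L hLk.2.1 h hwin
    have h3 := hfS β₁ hone (hβ₁le.trans hβa₁) L hLk.2.2.1 h hwin
    have h5 := hfT β₁ hone (hβ₁le.trans hβa₂) L hLk.2.2.2 h hwin
    have hrat := thermalRatchet_dWaveSource L U μ h hβ₁pos hβ₁le
    have hlogβ₁ : 0 ≤ Real.log β₁ := Real.log_nonneg hone
    have hcut : Real.log (1 / (|h| + 1 / β)) ≤ Real.log β₁ + 1 :=
      log_cutoff_le_log_rung hβpos hβ₁pos hprev'
    -- 1/β₁² ≤ 4 h²
    have hinv : 1 / β₁ ^ 2 ≤ 4 * h ^ 2 := by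
      rw [div_le_iff₀ (by positivity)]
      have h6 : 1 < (|h| * (2 * β₁)) ^ 2 := by
        have h7 : 0 ≤ |h| * (2 * β₁) := by positivity
        nlinarith
      calc (1 : ℝ) ≤ (|h| * (2 * β₁)) ^ 2 := h6.le
        _ = 4 * h ^ 2 * β₁ ^ 2 := by rw [mul_pow, mul_pow, sq_abs]; ring
    change c₀ / 2 * h ^ 2 * Real.log (1 / (|h| + 1 / β)) - (C₀ + K + 4 * C₁ + 4 * K' + c₀) * h ^ 2 ≤
      P β U h - P β U 0
    change c₀ * h ^ 2 * Real.log β₁ - C₀ * h ^ 2 ≤ P β₁ 0 h - P β₁ 0 0 at h1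
    change P (β₁ / 2) 0 h - P β₁ 0 h ≤ C₁ / β₁ ^ 2 at h2
    change (P β₁ 0 h - P β₁ 0 0) - (c₀ / 4 * Real.log β₁ + K) * h ^ 2 ≤ P β₁ U h - P β₁ U 0 at h3
    change (P (β₁ / 2) U h - P β₁ U h) - (P (β₁ / 2) 0 h - P β₁ 0 h) ≤
      (c₀ / 16 * Real.log β₁ + K') / β₁ ^ 2 at h5
    change (P β₁ U h - P β₁ U 0) - (P (β₁ / 2) U h - P β₁ U h) ≤ P β U h - P β U 0 at hrat
    -- the heat chord at β₁ in terms of h²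
    have hchord : P (β₁ / 2) U h - P β₁ U h ≤
        4 * (C₁ + K') * h ^ 2 + c₀ / 4 * h ^ 2 * Real.log β₁ := by
      have e1 : C₁ / β₁ ^ 2 = C₁ * (1 / β₁ ^ 2) := by ring
      have e2 : (c₀ / 16 * Real.log β₁ + K') / β₁ ^ 2 =
          (c₀ / 16 * Real.log β₁ + K') * (1 / β₁ ^ 2) := by ring
      have h8 : C₁ * (1 / β₁ ^ 2) ≤ C₁ * (4 * h ^ 2) := mul_le_mul_of_nonneg_left hinv hC₁.le
      have h9 : (c₀ / 16 * Real.log β₁ + K') * (1 / β₁ ^ 2) ≤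
          (c₀ / 16 * Real.log β₁ + K') * (4 * h ^ 2) :=
        mul_le_mul_of_nonneg_left hinv (by positivity)
      rw [e1] at h2
      rw [e2] at h5
      linarith [h2, h5, h8, h9]
    have h10 : c₀ / 2 * h ^ 2 * Real.log (1 / (|h| + 1 / β)) ≤ c₀ / 2 * h ^ 2 * (Real.log β₁ + 1) :=
      mul_le_mul_of_nonneg_left hcut (by positivity)
    have h11 : 0 ≤ c₀ * h ^ 2 := by positivity
    linarith [h1, h3, hrat, hchord, h10, h11]

end Summit.HubbardSuperconductivity.HubbardSuperconductivity.Theorems
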